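import Summits.BirchSwinnertonDyer.BirchSwinnertonDyer.Theorems.PrintCFramBottomClassIndexLawFiveLeCuspSeedTranscendentalConstant
import Mathlib.NumberTheory.Padics.PadicVal.Basic
import HarnessLib

set_option autoImplicit false

/-!
# Crux `PrintCFram.BottomClassIndexLawFiveLe` (stmt-BirchSwinnertonDyer-20372), line `eisenstein-resource-bdp-line` (registry v24):
# CUSP GLUE (β) part 2 — FROM THE FOUR ANALYTIC SOCKETS TO `v² = u·C²` WITH `u` A `p`-UNIT
# (cell `bsd-print-cfram`, width seat `bsd-line-cfram-p1-w2` g13; THEOREMS ONLY, `--supports` 20372; Mathlib currency;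
# BSD is not proved by any of this)

HONEST FRAMING. Pure algebra over `ℂ`/`ℚ` plus one `p`-adic valuation count; no modular form, no elliptic curve, no BSD.
Conjunct (iii) of the registered stub `stub_cuspCutForm` («`G = 0 ⟹ ι(C) = 0`», `C = B_{2k}/k!·m^{k−1}·Π_{q∣m}(q−1)(q^{2k}−1)/q^{2k+1}`)
is assembled (w8 g8's plan, STATUS 2026-08-29T04:17:31Z / 04:30:22Z; end of chain `CuspGlue.cuspConjunct_of_sq_eq`) from
`hsq : v ^ 2 = ((u * C ^ 2 : ℚ) : ℂ)` with `u ≠ 0`, `padicValRat p u = 0`, where `v = CT_0` is the constant term of the weight-`(k+1)`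
cusp vehicle at the cusp `0`. The four analytic sockets give, in order,
* Lemma A (`CuspSeed.tendsto_zpow_mul_apply_ofComplex_I_mul`, p691154): `y^{k+1}·F(iy) → Λ = i^{k+1}·v`;
* (α) (`CuspGlue.tendsto_rpow_smul_tsum_of_eq_mul_thetaMul`, w8 g8): `y^{k+½}·Σ a(n)e^{−2πny} → ℓ = Λ·√(2t)` (`t = Q²`);
* (E4) (`CuspSeed.tendsto_sub_mul_LSeries_of_tendsto_rpow_smul_tsum`, p695659): `(s−w)·L(a,s) → ((2π)^w/Γ(w))·ℓ`, `w = k+½`;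
* (E3) (w5 g6): the same limit is `R = A·π^{−k}·L(𝟙_{⊥m}, 2k)` with an ALGEBRAIC prefactor `A = a·∏_{q∣m, q≠2}(q−1)/(2q)`, `a ∈ ℚ`
  (announced spelling: `a = (−1)^{⌊k/2⌋}(k−1)!/2^{k−1}·c₂·c₃/m`, `c₂ = ⅛|¼`, `c₃ = 1|⅔`),
so that `((2π)^w/Γ(w))·ℓ = R` by uniqueness of limits. This file turns that EQUATION into `hsq`:

* §1 finset products over `m.primeFactors` (any field of characteristic `0`): `prod_primeFactors_sub_one_div_ne_zero`,
  **`prod_primeFactors_erase_two_eq`** (`∏_{q≠2}(q−1)/(2q) = 4^{[2∣m]}/2^{ω(m)}·∏_q (q−1)/q`), **`prod_primeFactors_cuspFactor_eq`**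
  (`∏_q (q−1)(q^{2k}−1)/q^{2k+1} = ∏_q(1−(q^{2k})⁻¹)·∏_q(q−1)/q`);
* §2 **`bernoulliRat_mul_eq_cuspConstant`**: the rational `r = (−1)^{k+1}B_{2k}/k!·∏(1−(q^{2k})⁻¹)` of part 1 against the REGISTERED
  constant: `r·(m^{k−1}·∏_q(q−1)/q) = (−1)^{k+1}·C`;
* §3 THE CHAIN: **`ell_eq_of_gammaFactor_mul_eq`** (`ℓ = A·r/(2^{k+1}√2)`), **`sq_cuspValue_eq_of_sockets`**
  (`v² = (−1)^{k+1}·A²·r²/(2^{2k+4}·t)`), **`sq_cuspValue_eq_ratCast_of_sockets`** (`A = a·∏_{q≠2}(q−1)/(2q)` ⟹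
  `v² = ((u·C²:ℚ):ℂ)`, `u = (−1)^{k+1}·a²·16^{[2∣m]}/(4^{ω(m)}·2^{2k+4}·t·m^{2k−2})`);
* §4 `p`-ADIC UNITS: `cuspUnit_ne_zero`, **`padicValRat_cuspUnit`** (`= 0` for `p ≠ 2`, `p ∤ m`, `p ∤ t`, `v_p(a) = 0`),
  and the packaged **`exists_cuspUnit_sq_eq_of_sockets`**: `∃ u, u ≠ 0 ∧ padicValRat p u = 0 ∧ v² = ((u·C²:ℚ):ℂ)`.
  (The announced-`R` twin and the adapters to the vehicle's verbatim socket shapes are in the sibling file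
  `…CuspSeedCuspValueSquaredVehicle.lean`.)

[folklore]
-/

-- summit-side namespace `Summit.BirchSwinnertonDyer.BirchSwinnertonDyer.…` (single-conjunct summit, D-0017 layout)
set_option linter.dupNamespace false

namespace Summit.BirchSwinnertonDyer.BirchSwinnertonDyer.Theorems.PrintCFram.CuspGlue

open Complex Finset Real
open scoped Nat

/-! ### §1. Finset products over the primes of `m` -/

section Products

variable {K : Type*} [Field K] [CharZero K]

/-- `∏_{q ∣ m prime} (q−1)/q ≠ 0`. [folklore] -/
theorem prod_primeFactors_sub_one_div_ne_zero (m : ℕ) :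
    ∏ q ∈ m.primeFactors, (((q : K) - 1) / q) ≠ 0 := by
  refine Finset.prod_ne_zero_iff.mpr fun q hq ↦ ?_
  have hq2 : 2 ≤ q := (Nat.prime_of_mem_primeFactors hq).two_le
  have hq1 : ((q : K) - 1) = ((q - 1 : ℕ) : K) := by rw [Nat.cast_sub (by omega), Nat.cast_one]
  have hq0 : (q : K) ≠ 0 := by exact_mod_cast (show q ≠ 0 by omega)
  rw [hq1]
  exact div_ne_zero (by exact_mod_cast (show q - 1 ≠ 0 by omega)) hq0

/-- **`∏_{q ∣ m, q ≠ 2} (q−1)/(2q) = 4^{[2∣m]}/2^{ω(m)} · ∏_{q ∣ m} (q−1)/q`** (`ω(m)` = number of prime factors): the odd-prime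
product of the family mean (w3 g13 `FamilyMean.tendsto_sub_one_mul_LSeries_family_euler`) against the full product of the
registered cusp constant. [folklore] -/
theorem prod_primeFactors_erase_two_eq {m : ℕ} (hm : m ≠ 0) :
    ∏ q ∈ m.primeFactors.erase 2, (((q : K) - 1) / (2 * q)) =
      (if 2 ∣ m then 4 else 1) / 2 ^ m.primeFactors.card * ∏ q ∈ m.primeFactors, (((q : K) - 1) / q) := by
  have hsplit : ∀ s : Finset ℕ, ∏ q ∈ s, (((q : K) - 1) / (2 * q)) = (∏ q ∈ s, (((q : K) - 1) / q)) / 2 ^ s.card := by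
    intro s
    rw [eq_div_iff (pow_ne_zero _ two_ne_zero), ← Finset.prod_const (2 : K), ← Finset.prod_mul_distrib]
    refine Finset.prod_congr rfl fun q _ ↦ ?_
    rw [div_mul_eq_mul_div, mul_comm ((q : K) - 1) 2, mul_div_mul_left _ _ (two_ne_zero)]
  have hm' : 0 < m := Nat.pos_of_ne_zero hm
  by_cases h2 : 2 ∣ m
  · have h2m : 2 ∈ m.primeFactors := Nat.mem_primeFactors.mpr ⟨Nat.prime_two, h2, hm'.ne'⟩
    rw [if_pos h2, hsplit, Finset.card_erase_of_mem h2m, ← Finset.mul_prod_erase _ _ h2m]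
    have hcard : 1 ≤ m.primeFactors.card := Finset.card_pos.mpr ⟨2, h2m⟩
    obtain ⟨c, hc⟩ := Nat.exists_eq_add_of_le hcard
    rw [hc, show 1 + c - 1 = c by omega, pow_add]
    push_cast
    field_simp
    ring
  · have h2m : 2 ∉ m.primeFactors := fun h ↦ h2 (Nat.dvd_of_mem_primeFactors h)
    rw [if_neg h2, Finset.erase_eq_of_notMem h2m, hsplit, one_div, inv_mul_eq_div]

/-- **`∏_{q ∣ m} (q−1)(q^{2k}−1)/q^{2k+1} = ∏_{q ∣ m}(1 − (q^{2k})⁻¹) · ∏_{q ∣ m}(q−1)/q`**: the product of the registered cusp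
constant splits as the Euler factors of `L(𝟙_{⊥m}, 2k)` times `∏ (q−1)/q`. [folklore] -/
theorem prod_primeFactors_cuspFactor_eq (m k : ℕ) :
    ∏ q ∈ m.primeFactors, (((q : K) - 1) * ((q : K) ^ (2 * k) - 1) / (q : K) ^ (2 * k + 1)) =
      (∏ q ∈ m.primeFactors, (1 - ((q : K) ^ (2 * k))⁻¹)) * ∏ q ∈ m.primeFactors, (((q : K) - 1) / q) := by
  rw [← Finset.prod_mul_distrib]
  refine Finset.prod_congr rfl fun q hq ↦ ?_
  have hq0 : (q : K) ≠ 0 := by exact_mod_cast (Nat.prime_of_mem_primeFactors hq).ne_zero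
  have hqk : (q : K) ^ (2 * k) ≠ 0 := pow_ne_zero _ hq0
  rw [pow_succ]
  field_simp

end Products

/-! ### §2. The rational `r` of part 1 against the registered cusp constant `C` -/

/-- **`r · (m^{k−1} · ∏_q (q−1)/q) = (−1)^{k+1} · C`** for `r = (−1)^{k+1}B_{2k}/k!·∏_q(1−(q^{2k})⁻¹)` (part 1,
`Gamma_div_rpow_mul_LSeries_coprime_two_mul_eq_ratCast`) and the REGISTERED
`C = B_{2k}/k!·m^{k−1}·∏_q (q−1)(q^{2k}−1)/q^{2k+1}` of `stub_cuspCutForm` (iii). [folklore] -/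
theorem bernoulliRat_mul_eq_cuspConstant (m k : ℕ) :
    ((-1) ^ (k + 1) * bernoulli (2 * k) / k ! * ∏ q ∈ m.primeFactors, (1 - ((q : ℚ) ^ (2 * k))⁻¹)) *
        ((m : ℚ) ^ (k - 1) * ∏ q ∈ m.primeFactors, (((q : ℚ) - 1) / q)) =
      (-1) ^ (k + 1) * (bernoulli (2 * k) / (k.factorial : ℚ) * (m : ℚ) ^ (k - 1) *
        ∏ q ∈ m.primeFactors, ((q : ℚ) - 1) * ((q : ℚ) ^ (2 * k) - 1) / (q : ℚ) ^ (2 * k + 1)) := by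
  rw [prod_primeFactors_cuspFactor_eq]
  ring

/-! ### §3. The chain from the sockets to `v²` -/

/-- The (E4) constant is invertible and its inverse is the part-1 factor: `(2π)^w/Γ(w) · Γ(w)/(2π)^w = 1` (`w = k + ½`).
[folklore] -/
theorem rpow_div_Gamma_mul_Gamma_div_rpow (k : ℕ) :
    (((2 * π) ^ ((k : ℝ) + 1 / 2) / Real.Gamma ((k : ℝ) + 1 / 2) : ℝ) : ℂ) *
        ((Real.Gamma (k + 1 / 2) / (2 * π) ^ ((k : ℝ) + 1 / 2) : ℝ) : ℂ) = 1 := by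
  have hΓ : Real.Gamma ((k : ℝ) + 1 / 2) ≠ 0 := (Real.Gamma_pos_of_pos (by positivity)).ne'
  have hP : (2 * π) ^ ((k : ℝ) + 1 / 2) ≠ 0 := (Real.rpow_pos_of_pos (by positivity) _).ne'
  rw [← Complex.ofReal_mul, div_mul_div_comm, mul_comm (Real.Gamma _), div_self (mul_ne_zero hP hΓ), Complex.ofReal_one]

/-- **Step 1 — `ℓ = A · r/(2^{k+1}√2)`.** If `((2π)^w/Γ(w))·ℓ = A·π^{−k}·L(𝟙_{⊥m}, 2k)` (the (E4) limit equals the (E3) limit,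
`w = k+½`, `A` the algebraic prefactor), then `ℓ = A·r/(2^{k+1}√2)` with the rational `r` of part 1. [folklore] -/
theorem ell_eq_of_gammaFactor_mul_eq {k m : ℕ} (hk : k ≠ 0) (hm : m ≠ 0) {ℓ A : ℂ}
    (hE : (((2 * π) ^ ((k : ℝ) + 1 / 2) / Real.Gamma ((k : ℝ) + 1 / 2) : ℝ) : ℂ) * ℓ =
      A / (π : ℂ) ^ k * LSeries (fun N ↦ if N.Coprime m then (1 : ℂ) else 0) (2 * k)) :
    ℓ = A * (((-1) ^ (k + 1) * bernoulli (2 * k) / k ! * ∏ q ∈ m.primeFactors, (1 - ((q : ℚ) ^ (2 * k))⁻¹) : ℚ) : ℂ) /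
      (2 ^ (k + 1) * (√2 : ℂ)) := by
  have h1 := rpow_div_Gamma_mul_Gamma_div_rpow k
  have h2 := Gamma_div_rpow_mul_LSeries_coprime_two_mul_eq_ratCast hk hm
  have hπ : (π : ℂ) ^ k ≠ 0 := pow_ne_zero _ (by exact_mod_cast Real.pi_pos.ne')
  set G := ((Real.Gamma (k + 1 / 2) / (2 * π) ^ ((k : ℝ) + 1 / 2) : ℝ) : ℂ) with hG
  set E := (((2 * π) ^ ((k : ℝ) + 1 / 2) / Real.Gamma ((k : ℝ) + 1 / 2) : ℝ) : ℂ) with hEdef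
  set L := LSeries (fun N ↦ if N.Coprime m then (1 : ℂ) else 0) (2 * k) with hL
  set r := (((-1) ^ (k + 1) * bernoulli (2 * k) / k ! * ∏ q ∈ m.primeFactors, (1 - ((q : ℚ) ^ (2 * k))⁻¹) : ℚ) : ℂ)
  calc ℓ = (E * G) * ℓ := by rw [h1, one_mul]
    _ = G * (E * ℓ) := by ring
    _ = G * (A / (π : ℂ) ^ k * L) := by rw [hE]
    _ = A / (π : ℂ) ^ k * (G * L) := by ring
    _ = A / (π : ℂ) ^ k * (r * ((π : ℂ) ^ k / (2 ^ (k + 1) * (√2 : ℂ)))) := by rw [h2]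
    _ = A * r / (2 ^ (k + 1) * (√2 : ℂ)) := by field_simp

/-- **Step 2 — `v² = (−1)^{k+1}·A²·r²/(2^{2k+4}·t)`.** From Lemma A (`Λ = i^{k+1}·v`), (α) (`ℓ = Λ·√(2t)`, `t > 0`) and Step 1.
[folklore] -/
theorem sq_cuspValue_eq_of_sockets {k m : ℕ} (hk : k ≠ 0) (hm : m ≠ 0) {t : ℝ} (ht : 0 < t) {v Λ ℓ A : ℂ}
    (hΛ : Λ = I ^ (k + 1) * v) (hℓ : ℓ = Λ * (Real.sqrt (2 * t) : ℂ))
    (hE : (((2 * π) ^ ((k : ℝ) + 1 / 2) / Real.Gamma ((k : ℝ) + 1 / 2) : ℝ) : ℂ) * ℓ =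
      A / (π : ℂ) ^ k * LSeries (fun N ↦ if N.Coprime m then (1 : ℂ) else 0) (2 * k)) :
    v ^ 2 = (-1) ^ (k + 1) * A ^ 2 *
      ((((-1) ^ (k + 1) * bernoulli (2 * k) / k ! * ∏ q ∈ m.primeFactors, (1 - ((q : ℚ) ^ (2 * k))⁻¹)) ^ 2 : ℚ) : ℂ) /
        (2 ^ (2 * k + 4) * (t : ℂ)) := by
  have h := ell_eq_of_gammaFactor_mul_eq hk hm hE
  rw [hℓ, hΛ] at h
  rw [Rat.cast_pow]
  set r := (((-1) ^ (k + 1) * bernoulli (2 * k) / k ! * ∏ q ∈ m.primeFactors, (1 - ((q : ℚ) ^ (2 * k))⁻¹) : ℚ) : ℂ)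
    with hr
  have hs2 : ((√2 : ℂ)) ^ 2 = 2 := by
    rw [← Complex.ofReal_pow, Real.sq_sqrt (by norm_num : (0:ℝ) ≤ 2)]; norm_num
  have hst : ((Real.sqrt (2 * t) : ℂ)) ^ 2 = 2 * t := by
    rw [← Complex.ofReal_pow, Real.sq_sqrt (by positivity)]; push_cast; ring
  have ht' : (t : ℂ) ≠ 0 := by exact_mod_cast ht.ne'
  have hIsq : ((I : ℂ) ^ (k + 1)) ^ 2 = (-1) ^ (k + 1) := by rw [← pow_mul, mul_comm, pow_mul, I_sq]
  have hinv : ((-1 : ℂ) ^ (k + 1)) * ((-1 : ℂ) ^ (k + 1)) = 1 := by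
    rw [← mul_pow, show (-1 : ℂ) * -1 = 1 by norm_num, one_pow]
  -- square the socket equation and clear denominators
  have hsq : (I ^ (k + 1) * v * (Real.sqrt (2 * t) : ℂ)) ^ 2 = (A * r / (2 ^ (k + 1) * (√2 : ℂ))) ^ 2 := by rw [h]
  rw [mul_pow, mul_pow, div_pow, mul_pow, mul_pow, hIsq, hst, hs2,
    eq_div_iff (mul_ne_zero (pow_ne_zero _ (pow_ne_zero _ two_ne_zero)) two_ne_zero)] at hsq
  rw [eq_div_iff (mul_ne_zero (pow_ne_zero _ two_ne_zero) ht')]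
  linear_combination ((-1 : ℂ) ^ (k + 1)) * hsq + (-(v ^ 2 * (t : ℂ) * 2 ^ (2 * k + 4))) * hinv

/-- **Step 3 — `v² = u·C²` with the REGISTERED `C`.** If the algebraic prefactor is `A = a · ∏_{q∣m, q≠2}(q−1)/(2q)` with `a ∈ ℚ`
(the (E3) spelling: `a = c_k·c₂·c₃/m`), then `v² = ((u·C² : ℚ) : ℂ)` with
`u = (−1)^{k+1}·a²·16^{[2∣m]}/(4^{ω(m)}·2^{2k+4}·t·m^{2k−2})` and `C = B_{2k}/k!·m^{k−1}·∏_q (q−1)(q^{2k}−1)/q^{2k+1}` VERBATIM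
as registered. [folklore] -/
theorem sq_cuspValue_eq_ratCast_of_sockets {k m t : ℕ} (hk : k ≠ 0) (hm : m ≠ 0) (ht : 0 < t) {v Λ ℓ : ℂ} {a : ℚ}
    (hΛ : Λ = I ^ (k + 1) * v) (hℓ : ℓ = Λ * (Real.sqrt (2 * t) : ℂ))
    (hE : (((2 * π) ^ ((k : ℝ) + 1 / 2) / Real.Gamma ((k : ℝ) + 1 / 2) : ℝ) : ℂ) * ℓ =
      ((a : ℂ) * ∏ q ∈ m.primeFactors.erase 2, (((q : ℂ) - 1) / (2 * q))) / (π : ℂ) ^ k *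
        LSeries (fun N ↦ if N.Coprime m then (1 : ℂ) else 0) (2 * k)) :
    v ^ 2 = (((-1) ^ (k + 1) * a ^ 2 * (if 2 ∣ m then 16 else 1) /
        (4 ^ m.primeFactors.card * 2 ^ (2 * k + 4) * t * (m : ℚ) ^ (2 * k - 2)) *
      (bernoulli (2 * k) / (k.factorial : ℚ) * (m : ℚ) ^ (k - 1) *
        ∏ q ∈ m.primeFactors, ((q : ℚ) - 1) * ((q : ℚ) ^ (2 * k) - 1) / (q : ℚ) ^ (2 * k + 1)) ^ 2 : ℚ) : ℂ) := by
  have ht' : (0 : ℝ) < (t : ℝ) := by exact_mod_cast ht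
  have h := sq_cuspValue_eq_of_sockets hk hm ht' hΛ (by simpa using hℓ) hE
  rw [h, prod_primeFactors_erase_two_eq hm]
  -- the rational bookkeeping
  have hC := bernoulliRat_mul_eq_cuspConstant m k
  set r : ℚ := (-1) ^ (k + 1) * bernoulli (2 * k) / k ! * ∏ q ∈ m.primeFactors, (1 - ((q : ℚ) ^ (2 * k))⁻¹) with hr
  set C : ℚ := bernoulli (2 * k) / (k.factorial : ℚ) * (m : ℚ) ^ (k - 1) *
    ∏ q ∈ m.primeFactors, ((q : ℚ) - 1) * ((q : ℚ) ^ (2 * k) - 1) / (q : ℚ) ^ (2 * k + 1) with hCdef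
  set P : ℚ := ∏ q ∈ m.primeFactors, (((q : ℚ) - 1) / q) with hP
  have hPc : (∏ q ∈ m.primeFactors, (((q : ℂ) - 1) / q)) = (P : ℂ) := by rw [hP]; push_cast; rfl
  have hP0 : P ≠ 0 := prod_primeFactors_sub_one_div_ne_zero m
  have hm0 : (m : ℚ) ≠ 0 := by exact_mod_cast hm
  have hsq1 : ((-1 : ℚ) ^ (k + 1)) ^ 2 = 1 := by rw [← pow_mul, mul_comm, pow_mul]; norm_num
  -- `r² = C² / (m^(k-1) P)²` (the sign squares away)
  have hr' : r = (-1) ^ (k + 1) * C / ((m : ℚ) ^ (k - 1) * P) := by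
    rw [eq_div_iff (mul_ne_zero (pow_ne_zero _ hm0) hP0)]; exact hC
  have hr2 : r ^ 2 = C ^ 2 / (((m : ℚ) ^ (k - 1)) ^ 2 * P ^ 2) := by
    rw [hr', div_pow, mul_pow, hsq1, one_mul]
    ring
  have hpow : (m : ℚ) ^ (2 * k - 2) = ((m : ℚ) ^ (k - 1)) ^ 2 := by
    rw [← pow_mul]; congr 1; omega
  rw [hPc, hpow]
  -- move everything to `ℚ`
  have hP0' : (P : ℂ) ≠ 0 := by exact_mod_cast hP0
  have hm0' : (m : ℂ) ≠ 0 := by exact_mod_cast hm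
  have ht0 : (t : ℂ) ≠ 0 := by exact_mod_cast ht.ne'
  have h4 : (4 : ℂ) ^ m.primeFactors.card = (2 ^ m.primeFactors.card) ^ 2 := by
    rw [← pow_mul, mul_comm, pow_mul]; norm_num
  have key : ∀ (e : ℚ), ((-1 : ℂ)) ^ (k + 1) * ((a : ℂ) * ((e : ℂ) / 2 ^ m.primeFactors.card * (P : ℂ))) ^ 2 *
      ((r ^ 2 : ℚ) : ℂ) / (2 ^ (2 * k + 4) * ((t : ℝ) : ℂ)) =
      (((-1) ^ (k + 1) * a ^ 2 * e ^ 2 / (4 ^ m.primeFactors.card * 2 ^ (2 * k + 4) * t * ((m : ℚ) ^ (k - 1)) ^ 2) *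
        C ^ 2 : ℚ) : ℂ) := by
    intro e
    rw [hr2]
    push_cast
    rw [h4]
    field_simp
  split_ifs with h2
  · have := key 4
    norm_num at this ⊢
    exact this
  · have := key 1
    norm_num at this ⊢
    exact this

/-! ### §4. The unit `u` is a `p`-adic unit -/

/-- `u ≠ 0`. [folklore] -/
theorem cuspUnit_ne_zero {k m t : ℕ} (hm : m ≠ 0) (ht : 0 < t) {a : ℚ} (ha : a ≠ 0) :
    ((-1) ^ (k + 1) * a ^ 2 * (if 2 ∣ m then 16 else 1) /
        (4 ^ m.primeFactors.card * 2 ^ (2 * k + 4) * t * (m : ℚ) ^ (2 * k - 2)) : ℚ) ≠ 0 := by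
  have hm0 : (m : ℚ) ≠ 0 := by exact_mod_cast hm
  have ht0 : (t : ℚ) ≠ 0 := by exact_mod_cast ht.ne'
  have h16 : ((if 2 ∣ m then 16 else 1 : ℚ)) ≠ 0 := by split_ifs <;> norm_num
  refine div_ne_zero (mul_ne_zero (mul_ne_zero (pow_ne_zero _ (by norm_num)) (pow_ne_zero _ ha)) h16) ?_
  exact mul_ne_zero (mul_ne_zero (mul_ne_zero (pow_ne_zero _ (by norm_num)) (pow_ne_zero _ (by norm_num))) ht0)
    (pow_ne_zero _ hm0)

/-- **`v_p(u) = 0`** for a prime `p ≠ 2` with `p ∤ m`, `p ∤ t` and `v_p(a) = 0`, `a ≠ 0`. [folklore] -/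
theorem padicValRat_cuspUnit {p k m t : ℕ} [hp : Fact p.Prime] (hp2 : p ≠ 2) (hm : ¬ p ∣ m) (ht : ¬ p ∣ t) (ht0 : 0 < t)
    {a : ℚ} (ha0 : a ≠ 0) (ha : padicValRat p a = 0) :
    padicValRat p ((-1) ^ (k + 1) * a ^ 2 * (if 2 ∣ m then 16 else 1) /
        (4 ^ m.primeFactors.card * 2 ^ (2 * k + 4) * t * (m : ℚ) ^ (2 * k - 2)) : ℚ) = 0 := by
  have hm0 : m ≠ 0 := fun h ↦ hm (h ▸ dvd_zero p)
  have hmq : (m : ℚ) ≠ 0 := by exact_mod_cast hm0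
  have htq : (t : ℚ) ≠ 0 := by exact_mod_cast ht0.ne'
  have hp2' : ¬ p ∣ 2 := fun h ↦ hp2 ((Nat.prime_dvd_prime_iff_eq hp.out Nat.prime_two).mp h)
  have hp4 : ¬ p ∣ 4 := fun h ↦ hp2' (by
    have := (Nat.Prime.dvd_mul hp.out).mp (show p ∣ 2 * 2 by simpa using h); tauto)
  have hp16 : ¬ p ∣ 16 := fun h ↦ hp4 (by
    have := (Nat.Prime.dvd_mul hp.out).mp (show p ∣ 4 * 4 by simpa using h); tauto)
  have v2 : padicValRat p (2 : ℚ) = 0 := by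
    rw [show (2 : ℚ) = ((2 : ℕ) : ℚ) by norm_num, padicValRat.of_nat, padicValNat.eq_zero_of_not_dvd hp2']; simp
  have v4 : padicValRat p (4 : ℚ) = 0 := by
    rw [show (4 : ℚ) = ((4 : ℕ) : ℚ) by norm_num, padicValRat.of_nat, padicValNat.eq_zero_of_not_dvd hp4]; simp
  have v16 : padicValRat p ((if 2 ∣ m then 16 else 1 : ℚ)) = 0 := by
    split_ifs
    · rw [show (16 : ℚ) = ((16 : ℕ) : ℚ) by norm_num, padicValRat.of_nat, padicValNat.eq_zero_of_not_dvd hp16]; simp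
    · exact padicValRat.one
  have vm : padicValRat p (m : ℚ) = 0 := by
    rw [padicValRat.of_nat, padicValNat.eq_zero_of_not_dvd hm]; simp
  have vt : padicValRat p (t : ℚ) = 0 := by
    rw [padicValRat.of_nat, padicValNat.eq_zero_of_not_dvd ht]; simp
  have vm1 : padicValRat p (-1 : ℚ) = 0 := by rw [padicValRat.neg, padicValRat.one]
  have h16 : ((if 2 ∣ m then 16 else 1 : ℚ)) ≠ 0 := by split_ifs <;> norm_num
  have hneg : ((-1 : ℚ) ^ (k + 1)) ≠ 0 := pow_ne_zero _ (by norm_num)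
  have ha2 : a ^ 2 ≠ 0 := pow_ne_zero _ ha0
  have h4 : ((4 : ℚ) ^ m.primeFactors.card) ≠ 0 := pow_ne_zero _ (by norm_num)
  have h2k : ((2 : ℚ) ^ (2 * k + 4)) ≠ 0 := pow_ne_zero _ (by norm_num)
  have hmk : ((m : ℚ) ^ (2 * k - 2)) ≠ 0 := pow_ne_zero _ hmq
  rw [padicValRat.div (mul_ne_zero (mul_ne_zero hneg ha2) h16) (mul_ne_zero (mul_ne_zero (mul_ne_zero h4 h2k) htq) hmk),
    padicValRat.mul (mul_ne_zero hneg ha2) h16, padicValRat.mul hneg ha2,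
    padicValRat.mul (mul_ne_zero (mul_ne_zero h4 h2k) htq) hmk, padicValRat.mul (mul_ne_zero h4 h2k) htq,
    padicValRat.mul h4 h2k]
  simp only [padicValRat.pow, vm1, ha, v16, v4, v2, vt, vm, mul_zero, add_zero, sub_zero]

/-- **PACKAGED — the `hsq` socket of `CuspGlue.cuspConjunct_of_sq_eq`.** From the four analytic sockets (Lemma A, (α), and
the (E4) = (E3) equation with prefactor `a·∏_{q∣m, q≠2}(q−1)/(2q)`, `a ∈ ℚ^×` a `p`-adic unit), for a prime `p ≠ 2` with
`p ∤ m`, `p ∤ t`: `∃ u ∈ ℚ, u ≠ 0 ∧ v_p(u) = 0 ∧ v² = ((u·C² : ℚ) : ℂ)` with the REGISTERED `C`. [folklore] -/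
theorem exists_cuspUnit_sq_eq_of_sockets {p k m t : ℕ} [Fact p.Prime] (hp2 : p ≠ 2) (hk : k ≠ 0)
    (hpm : ¬ p ∣ m) (hpt : ¬ p ∣ t) (ht : 0 < t) {v Λ ℓ : ℂ} {a : ℚ} (ha0 : a ≠ 0) (ha : padicValRat p a = 0)
    (hΛ : Λ = I ^ (k + 1) * v) (hℓ : ℓ = Λ * (Real.sqrt (2 * t) : ℂ))
    (hE : (((2 * π) ^ ((k : ℝ) + 1 / 2) / Real.Gamma ((k : ℝ) + 1 / 2) : ℝ) : ℂ) * ℓ =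
      ((a : ℂ) * ∏ q ∈ m.primeFactors.erase 2, (((q : ℂ) - 1) / (2 * q))) / (π : ℂ) ^ k *
        LSeries (fun N ↦ if N.Coprime m then (1 : ℂ) else 0) (2 * k)) :
    ∃ u : ℚ, u ≠ 0 ∧ padicValRat p u = 0 ∧
      v ^ 2 = ((u * (bernoulli (2 * k) / (k.factorial : ℚ) * (m : ℚ) ^ (k - 1) *
        ∏ q ∈ m.primeFactors, ((q : ℚ) - 1) * ((q : ℚ) ^ (2 * k) - 1) / (q : ℚ) ^ (2 * k + 1)) ^ 2 : ℚ) : ℂ) := by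
  have hm : m ≠ 0 := fun h ↦ hpm (h ▸ dvd_zero p)
  exact ⟨_, cuspUnit_ne_zero (k := k) hm ht ha0, padicValRat_cuspUnit (k := k) hp2 hpm hpt ht ha0 ha,
    sq_cuspValue_eq_ratCast_of_sockets hk hm ht hΛ hℓ hE⟩

end Summit.BirchSwinnertonDyer.BirchSwinnertonDyer.Theorems.PrintCFram.CuspGlue
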